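import Mathlib
import Literature.NumberTheory.LFunctions.Zhang2022.Section15CalM1Ratio
import HarnessLib

/-!
# Zhang (2022) §15 p. 86: §15.u040 and (15.21) on the whole support `n < P` of `b(n₁n)`

Topic `Literature/NumberTheory/LFunctions/Zhang2022` (Landau–Siegel audit tree; verdict-neutral).
Y. Zhang, *Discrete mean estimates and the Landau–Siegel zero*, arXiv:2211.02515v1 (2022)
[Zhang2022LandauSiegel] — **an unrefereed manuscript under adjudication; nothing here asserts or denies
its Theorems 1–2.** ZHANG-L discharge lane (WP15), helper for the leaf
`h15_22 : Typed.Section15C.Eq15_22 c′ Typed.Section15C.inputs15ABchi` (DAG node `Z22:(15.22)`).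

The displays §15.u040 / (15.21) [Z22 §15 p. 86, tex L4258–L4262] are printed (and typed,
`Typed.Section15B.Step15_u040` / `Eq15_21`) for `n < PT⁻³`; their consumer, the deduction of (15.22)
(tree edge `Typed.Section15C.eq15_22_chi_of_parts`), applies (15.21) to the rough variable `n` on the
whole support of `b(n₁n)`, `n₁n < PT⁻²η₊` — so up to `n < PT⁻²η₊ > PT⁻³` (WP15 typer note (i),
`WP15-TYPED-INVENTORY.md` §3). The tree proof of §15.u040 (zl-w15-p4, `Typed.Section15B.step15_u040_holds`,
file `Section15CalM1Ratio`) uses the size of `n` only through `log n ≤ log P = 𝓛⁹`; this file re-runs it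
VERBATIM with the range hypothesis `n < P` (theorems only; the private local lemmas of that file are
re-proved here since they are not exported):

* `step15_u040_wide` — §15.u040 for `n = dl < P`, `(n,𝒬) = 1` (error `C·D⁻²`);
* `eq15_21_wide` — (15.21) for `1 ≤ n < P`, `(n,𝒬) = 1`: `‖ϖ₁ⱼ(n) − χ(n)ϱ*ⱼ(n)‖ ≤ Cτ₂(n)D⁻²`, in the
  exact hypothesis shape of `eq15_22_chi_of_parts`.

WHAT THIS IS NOT: a new claim of the manuscript (no `def`); nothing about Theorems 1–2.

## References
* Y. Zhang, arXiv:2211.02515v1 (2022), §15 p. 86, (15.21). [cite: Zhang2022LandauSiegel, §15 (15.21) p.86]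
-/

noncomputable section

open Complex Real
open Literature.NumberTheory.LFunctions.Zhang2022.Skeleton
open Literature.NumberTheory.LFunctions.Zhang2022.Typed.Section15A

namespace Literature.NumberTheory.LFunctions.Zhang2022.Typed.Section15B

/-! ## Local lemmas (as in `Section15CalM1Ratio`, where they are private) -/

/-- A natural number all of whose prime factors are `≥ z > 1` has at most `log n/log z` of them
(`z^{ω(n)} ≤ ∏_{q∣n} q ≤ n`). [folklore] -/
private theorem card_primeFactors_le_log_div {n : ℕ} (hn : n ≠ 0) {z : ℝ} (hz : 1 < z)
    (hr : ∀ p ∈ n.primeFactors, z ≤ (p : ℝ)) :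
    (n.primeFactors.card : ℝ) ≤ Real.log n / Real.log z := by
  have hz0 : 0 < z := by linarith
  have h1 : z ^ n.primeFactors.card ≤ ∏ p ∈ n.primeFactors, (p : ℝ) := by
    rw [← Finset.prod_const]
    exact Finset.prod_le_prod (fun _ _ => hz0.le) fun p hp => hr p hp
  have h2 : ∏ p ∈ n.primeFactors, (p : ℝ) ≤ n := by
    have h3 : ∏ p ∈ n.primeFactors, p ≤ n :=
      Nat.le_of_dvd (Nat.pos_of_ne_zero hn) (Nat.prod_primeFactors_dvd n)
    have h4 : ((∏ p ∈ n.primeFactors, p : ℕ) : ℝ) ≤ n := by exact_mod_cast h3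
    rwa [Nat.cast_prod] at h4
  have h5 := Real.log_le_log (by positivity) (h1.trans h2)
  rw [Real.log_pow] at h5
  rw [le_div_iff₀ (Real.log_pos hz)]
  exact h5

/-- One local factor of §15.u040: if `‖F − 1‖ ≤ a`, `‖F₀ − 1‖ ≤ b ≤ 1/2` and `‖μ − 1‖ ≤ m`, then
`‖μ·F/F₀ − 1‖ ≤ 2(a+b)(1+m) + m`. [folklore] -/
private theorem norm_mul_div_sub_one_le {F F₀ μ : ℂ} {a b m : ℝ} (hF : ‖F - 1‖ ≤ a) (hF₀ : ‖F₀ - 1‖ ≤ b)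
    (hb : b ≤ 1 / 2) (hμ : ‖μ - 1‖ ≤ m) :
    ‖μ * (F / F₀) - 1‖ ≤ 2 * (a + b) * (1 + m) + m := by
  have ha0 : 0 ≤ a := (norm_nonneg _).trans hF
  have hb0 : 0 ≤ b := (norm_nonneg _).trans hF₀
  have hm0 : 0 ≤ m := (norm_nonneg _).trans hμ
  have hF₀n : 1 / 2 ≤ ‖F₀‖ := by
    have := norm_sub_norm_le (1 : ℂ) F₀
    rw [norm_one, norm_sub_rev] at this
    linarith
  have hF₀0 : F₀ ≠ 0 := by
    intro h; rw [h, norm_zero] at hF₀n; linarith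
  have hr : ‖F / F₀ - 1‖ ≤ 2 * (a + b) := by
    rw [div_sub_one hF₀0, norm_div]
    have hnum : ‖F - F₀‖ ≤ a + b := by
      calc ‖F - F₀‖ = ‖(F - 1) - (F₀ - 1)‖ := by ring_nf
        _ ≤ ‖F - 1‖ + ‖F₀ - 1‖ := norm_sub_le _ _
        _ ≤ a + b := add_le_add hF hF₀
    rw [div_le_iff₀ (by linarith)]
    nlinarith
  have hrn : ‖F / F₀‖ ≤ 1 + 2 * (a + b) := by
    have := norm_add_le (F / F₀ - 1) 1
    rw [sub_add_cancel, norm_one] at this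
    linarith
  calc ‖μ * (F / F₀) - 1‖ = ‖(μ - 1) * (F / F₀) + (F / F₀ - 1)‖ := by ring_nf
    _ ≤ ‖(μ - 1) * (F / F₀)‖ + ‖F / F₀ - 1‖ := norm_add_le _ _
    _ = ‖μ - 1‖ * ‖F / F₀‖ + ‖F / F₀ - 1‖ := by rw [norm_mul]
    _ ≤ m * (1 + 2 * (a + b)) + 2 * (a + b) := by
        gcongr
    _ = 2 * (a + b) * (1 + m) + m := by ring

/-- `‖∏_{i∈S} g i − 1‖ ≤ exp(Σ_{i∈S} ‖g i − 1‖) − 1` (Mathlib `Finset.norm_prod_one_add_sub_one_le`).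
[folklore] -/
private theorem norm_prod_sub_one_le' {ι : Type*} (S : Finset ι) (g : ι → ℂ) :
    ‖∏ i ∈ S, g i - 1‖ ≤ Real.exp (∑ i ∈ S, ‖g i - 1‖) - 1 := by
  have h := S.norm_prod_one_add_sub_one_le (fun i => g i - 1)
  simpa only [add_sub_cancel] using h

/-- Real-power bookkeeping for the primes `q ≥ D⁴` of §15.u040 (`D ≥ 2`, `Q = q`): `Q ≥ 16`,
`Q^{−19/10} ≤ Q^{−9/10}`, `8/Q ≤ 8Q^{−9/10}`, `Q^{−9/10} ≤ 1` and `Q^{−9/10} ≤ D⁻³`. [folklore] -/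
private theorem rpow_facts {D q : ℕ} (hD : 2 ≤ D) (hq : D ^ 4 ≤ q) :
    (16 : ℝ) ≤ q ∧ (q : ℝ) ^ (-(19 / 10 : ℝ)) ≤ (q : ℝ) ^ (-(9 / 10 : ℝ)) ∧
      8 / (q : ℝ) ≤ 8 * (q : ℝ) ^ (-(9 / 10 : ℝ)) ∧ (q : ℝ) ^ (-(9 / 10 : ℝ)) ≤ 1 ∧
        (q : ℝ) ^ (-(9 / 10 : ℝ)) ≤ (D : ℝ) ^ (-(3 : ℝ)) := by
  have hD16 : 16 ≤ D ^ 4 := by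
    calc 16 = 2 ^ 4 := by norm_num
      _ ≤ D ^ 4 := Nat.pow_le_pow_left hD 4
  have hq16 : (16 : ℝ) ≤ q := by exact_mod_cast hD16.trans hq
  have hq1 : (1 : ℝ) ≤ q := by linarith
  have hq0 : (0 : ℝ) < q := by linarith
  have hD1 : (1 : ℝ) ≤ D := by exact_mod_cast (show 1 ≤ D by omega)
  have hD0 : (0 : ℝ) < D := by linarith
  refine ⟨hq16, Real.rpow_le_rpow_of_exponent_le hq1 (by norm_num), ?_, ?_, ?_⟩
  · have : 1 / (q : ℝ) ≤ (q : ℝ) ^ (-(9 / 10 : ℝ)) := by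
      rw [one_div, ← Real.rpow_neg_one]
      exact Real.rpow_le_rpow_of_exponent_le hq1 (by norm_num)
    calc 8 / (q : ℝ) = 8 * (1 / q) := by ring
      _ ≤ 8 * (q : ℝ) ^ (-(9 / 10 : ℝ)) := by gcongr
  · calc (q : ℝ) ^ (-(9 / 10 : ℝ)) ≤ (q : ℝ) ^ (0 : ℝ) :=
          Real.rpow_le_rpow_of_exponent_le hq1 (by norm_num)
      _ = 1 := Real.rpow_zero _
  · have hDq : ((D : ℝ) ^ 4) ≤ q := by exact_mod_cast hq
    calc (q : ℝ) ^ (-(9 / 10 : ℝ)) ≤ ((D : ℝ) ^ 4) ^ (-(9 / 10 : ℝ)) :=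
          Real.rpow_le_rpow_of_nonpos (by positivity) hDq (by norm_num)
      _ = (D : ℝ) ^ (-(18 / 5 : ℝ)) := by
          rw [← Real.rpow_natCast, ← Real.rpow_mul hD0.le]; norm_num
      _ ≤ (D : ℝ) ^ (-(3 : ℝ)) := Real.rpow_le_rpow_of_exponent_le hD1 (by norm_num)

/-- `𝓛⁸ ≤ 8!·D` (`x⁸/8! ≤ eˣ` at `x = log D`). [folklore] -/
private theorem ell_pow_eight_le {D : ℕ} (hD : 2 ≤ D) : ell D ^ 8 ≤ 40320 * (D : ℝ) := by
  have hD0 : (0 : ℝ) < D := by exact_mod_cast (show 0 < D by omega)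
  have hℓ0 : 0 ≤ ell D := Real.log_nonneg (by exact_mod_cast (show 1 ≤ D by omega))
  have h := Real.pow_div_factorial_le_exp (ell D) hℓ0 8
  rw [show ((Nat.factorial 8 : ℕ) : ℝ) = 40320 by norm_num [Nat.factorial], ell,
    Real.exp_log hD0, div_le_iff₀ (by norm_num : (0:ℝ) < 40320)] at h
  rw [ell]; linarith

/-! ## §15.u040 and (15.21) for `n < P` -/

/-- **§15.u040 on the whole support `n < P`** (the printed display restricts to `n < PT⁻³`, tex
L4258; the local-ratio argument does not use the size of `n` beyond `log n ≤ 𝓛⁹`): for all large `D`,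
under (A), for `1 ≤ j ≤ 3`, `n = dl < P` with `(n,𝒬) = 1`: `‖λ₁(d)𝓜₁(d,l;1−βⱼ)/𝓜₁(1,1;1−βⱼ) − 1‖ ≤
C·D⁻²`. Proof = zl-w15-p4's `step15_u040_holds` (`Section15CalM1Ratio`) verbatim with the range
hypothesis weakened (adapted from that file; its local lemmas are private there and re-proved here).
[cite: Zhang2022LandauSiegel, §15 p.86] -/
theorem step15_u040_wide (c' : ℝ) :
    ∃ c : ℝ, 0 < c ∧ ∃ C : ℝ, Skeleton.ForAllLarge fun D _ χ => Skeleton.AssumptionA D χ →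
      ∀ j ∈ ({1, 2, 3} : Finset ℕ), ∀ n d l : ℕ, 1 ≤ n → d * l = n →
        (n : ℝ) < Skeleton.bigP D → Nat.Coprime n (Skeleton.frakq D) →
          ‖lam1 c' χ d 1 * calM1 c' χ d l (1 - Skeleton.betaJ c' D j) /
                calM1 c' χ 1 1 (1 - Skeleton.betaJ c' D j) - 1‖ ≤
            C * (D : ℝ) ^ (-c) := by
  classical
  obtain ⟨C₂, h32⟩ := step15_u032_holds c'
  obtain ⟨C₃, h33⟩ := step15_u033_holds c'
  set C₂' : ℝ := max C₂ 0 with hC₂'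
  set C₃' : ℝ := max C₃ 0 with hC₃'
  set K : ℝ := 18 * (C₂' + C₃') + 8 with hK
  have hC₂'0 : 0 ≤ C₂' := le_max_right _ _
  have hC₃'0 : 0 ≤ C₃' := le_max_right _ _
  have hK0 : 0 ≤ K := by rw [hK]; positivity
  -- threshold: `D ≥ N` with `N ≥ 2`, `N ≥ 2C₂'`, `N ≥ 10080·K`
  set N : ℕ := max 2 (max ⌈2 * C₂'⌉₊ ⌈10080 * K⌉₊) with hN
  have hT : ForAllLarge fun D _ _ => N ≤ D := ForAllLarge.of_le N fun _ _ _ hD _ _ => hD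
  refine ⟨2, by norm_num, 20160 * K, ?_⟩
  refine ((((h32.and h33).and (calM1_div_eq_prod_factor_div_eventually c')).and
    (norm_calM1_one_one_betaJ_ge c')).and hT).mono fun D _ χ _ _ h hA j hj n d l hn hdl hnP hcop => ?_
  obtain ⟨⟨⟨⟨g32, g33⟩, grat⟩, gne⟩, hND⟩ := h
  have hD2 : 2 ≤ D := (le_max_left _ _).trans hND
  have hDC₂ : 2 * C₂' ≤ D := le_trans (Nat.le_ceil _)
    (by exact_mod_cast ((le_max_left _ _).trans ((le_max_right _ _).trans hND)))
  have hDK : 10080 * K ≤ D := le_trans (Nat.le_ceil _)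
    (by exact_mod_cast ((le_max_right _ _).trans ((le_max_right _ _).trans hND)))
  have hD0 : (0 : ℝ) < D := by exact_mod_cast (show 0 < D by omega)
  have hD1 : (1 : ℝ) ≤ D := by exact_mod_cast (show 1 ≤ D by omega)
  -- the point `s = 1 − βⱼ`
  obtain ⟨-, hsre1, hnorm⟩ := gne hA j hj
  set s : ℂ := 1 - Skeleton.betaJ c' D j with hs
  have hsre : 9 / 10 < s.re := by rw [hsre1]; norm_num
  have hM0 : calM1 c' χ 1 1 s ≠ 0 := by
    intro h0; rw [h0, norm_zero] at hnorm; linarith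
  -- `d, l ≥ 1`, the prime factors of `n`
  have hn0 : n ≠ 0 := by omega
  have hd : 1 ≤ d := Nat.pos_of_ne_zero fun h0 => hn0 (by rw [← hdl, h0, zero_mul])
  have hl : 1 ≤ l := Nat.pos_of_ne_zero fun h0 => hn0 (by rw [← hdl, h0, mul_zero])
  set S : Finset ℕ := n.primeFactors with hSdef
  have hq4 : ∀ q ∈ S, D ^ 4 ≤ q := fun q hq =>
    pow_four_le_of_mem_primeFactors_of_coprime_frakq hcop hq
  -- the quantity as a product over `S`
  set μ : ℕ → ℂ := fun q => if q ∣ d then lam1 c' χ q 1 else 1 with hμ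
  have hlam : lam1 c' χ d 1 = ∏ q ∈ S, μ q := by
    rw [lam1_eq_prod_primeFactors, hμ, Finset.prod_ite, Finset.prod_const_one, mul_one]
    refine Finset.prod_congr ?_ fun q _ => rfl
    ext q
    rw [Finset.mem_filter, hSdef, ← hdl, Nat.mem_primeFactors, Nat.mem_primeFactors]
    constructor
    · rintro ⟨hqP, hqd, hd0⟩
      exact ⟨⟨hqP, dvd_mul_of_dvd_left hqd l, Nat.mul_ne_zero hd0 (by omega)⟩, hqd⟩
    · rintro ⟨⟨hqP, -, -⟩, hqd⟩
      exact ⟨hqP, hqd, by omega⟩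
  have hprod : lam1 c' χ d 1 * calM1 c' χ d l s / calM1 c' χ 1 1 s =
      ∏ q ∈ S, μ q * (calM1Factor c' χ q d l s / calM1Factor c' χ q 1 1 s) := by
    rw [mul_div_assoc, grat hA d l hd hl s hsre hM0, hlam, hSdef, ← hdl, ← Finset.prod_mul_distrib]
  rw [hprod]
  -- the local estimates
  have hloc : ∀ q ∈ S, ‖μ q * (calM1Factor c' χ q d l s / calM1Factor c' χ q 1 1 s) - 1‖ ≤
      K * (D : ℝ) ^ (-(3 : ℝ)) := by
    intro q hq
    have hqP : q.Prime := Nat.prime_of_mem_primeFactors hq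
    have hqn : q ∣ n := Nat.dvd_of_mem_primeFactors hq
    obtain ⟨hq16, h19, h8, hle1, hqD⟩ := rpow_facts hD2 (hq4 q hq)
    have hq0 : (0 : ℝ) < q := by linarith
    have hrp0 : 0 ≤ (q : ℝ) ^ (-(9 / 10 : ℝ)) := Real.rpow_nonneg hq0.le _
    -- `F_q(d,l) = 1 + O(q^{-9/10})` (u033: `q ∣ dl`)
    have hncop : ¬ Nat.Coprime q (d * l) := by
      rw [hdl, Nat.Prime.coprime_iff_not_dvd hqP, not_not]; exact hqn
    have eF : ‖calM1Factor c' χ q d l s - 1‖ ≤ C₃' * (q : ℝ) ^ (-(9 / 10 : ℝ)) :=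
      (g33 hA q d l hqP hd hl hncop s hsre).trans
        (mul_le_mul_of_nonneg_right (le_max_left _ _) hrp0)
    -- `F_q(1,1) = 1 + O(q^{-19/10})` (u032: `(q,1) = 1`)
    have eF₀ : ‖calM1Factor c' χ q 1 1 s - 1‖ ≤ C₂' * (q : ℝ) ^ (-(9 / 10 : ℝ)) := by
      have h := g32 hA q 1 1 hqP le_rfl le_rfl (Nat.coprime_one_right q) s hsre
      exact h.trans ((mul_le_mul_of_nonneg_right (le_max_left _ _)
        (Real.rpow_nonneg hq0.le _)).trans (mul_le_mul_of_nonneg_left h19 hC₂'0))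
    have hb : C₂' * (q : ℝ) ^ (-(9 / 10 : ℝ)) ≤ 1 / 2 := by
      have h3 : (D : ℝ) ^ (-(3 : ℝ)) ≤ (D : ℝ) ^ (-(1 : ℝ)) :=
        Real.rpow_le_rpow_of_exponent_le hD1 (by norm_num)
      rw [Real.rpow_neg_one] at h3
      calc C₂' * (q : ℝ) ^ (-(9 / 10 : ℝ)) ≤ C₂' * (D : ℝ)⁻¹ :=
            mul_le_mul_of_nonneg_left (hqD.trans h3) hC₂'0
        _ = C₂' / D := by ring
        _ ≤ 1 / 2 := by rw [div_le_iff₀ hD0]; linarith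
    -- `μ_q = 1 + O(1/q)`
    have eμ : ‖μ q - 1‖ ≤ 8 * (q : ℝ) ^ (-(9 / 10 : ℝ)) := by
      have h1 : ‖μ q - 1‖ ≤ 8 / q := by
        simp only [hμ]
        split_ifs
        · exact norm_lam1_prime_one_sub_one_le c' χ hqP
        · rw [sub_self, norm_zero]; positivity
      exact h1.trans h8
    have hloc1 := norm_mul_div_sub_one_le eF eF₀ hb eμ
    refine hloc1.trans ?_
    -- `2(C₃'+C₂')x(1+8x) + 8x ≤ K·x ≤ K·D⁻³` with `x = q^{-9/10} ≤ 1`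
    have hx1 : 8 * (q : ℝ) ^ (-(9 / 10 : ℝ)) ≤ 8 := by nlinarith
    calc 2 * (C₃' * (q : ℝ) ^ (-(9 / 10 : ℝ)) + C₂' * (q : ℝ) ^ (-(9 / 10 : ℝ))) *
          (1 + 8 * (q : ℝ) ^ (-(9 / 10 : ℝ))) + 8 * (q : ℝ) ^ (-(9 / 10 : ℝ))
        ≤ 2 * (C₃' * (q : ℝ) ^ (-(9 / 10 : ℝ)) + C₂' * (q : ℝ) ^ (-(9 / 10 : ℝ))) * (1 + 8) +
          8 * (q : ℝ) ^ (-(9 / 10 : ℝ)) := by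
          gcongr
      _ = K * (q : ℝ) ^ (-(9 / 10 : ℝ)) := by rw [hK]; ring
      _ ≤ K * (D : ℝ) ^ (-(3 : ℝ)) := mul_le_mul_of_nonneg_left hqD hK0
  -- the number of primes
  have hcard : (S.card : ℝ) ≤ ell D ^ 8 / 4 := by
    have hz : (1 : ℝ) < (D : ℝ) ^ 4 :=
      one_lt_pow₀ (by exact_mod_cast (show 1 < D by omega)) (by norm_num)
    have h1 := card_primeFactors_le_log_div hn0 hz (fun p hp => by exact_mod_cast hq4 p hp)
    have hlogn : Real.log n ≤ ell D ^ 9 := by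
      have hn1 : (0 : ℝ) < n := by exact_mod_cast Nat.pos_of_ne_zero hn0
      have hnP' : (n : ℝ) ≤ Skeleton.bigP D := hnP.le
      calc Real.log n ≤ Real.log (Skeleton.bigP D) := Real.log_le_log hn1 hnP'
        _ = ell D ^ 9 := by rw [Skeleton.bigP, Real.log_exp]
    have hlog4 : Real.log ((D : ℝ) ^ 4) = 4 * ell D := by rw [Real.log_pow, ell]; push_cast; ring
    rw [hlog4] at h1
    have hℓ0 : 0 < ell D := Real.log_pos (by exact_mod_cast (show 1 < D by omega))
    calc (S.card : ℝ) ≤ Real.log n / (4 * ell D) := h1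
      _ ≤ ell D ^ 9 / (4 * ell D) := by gcongr
      _ = ell D ^ 8 / 4 := by field_simp
  -- the sum of the local errors
  have hsum : ∑ q ∈ S, ‖μ q * (calM1Factor c' χ q d l s / calM1Factor c' χ q 1 1 s) - 1‖ ≤
      10080 * K * (D : ℝ) ^ (-(2 : ℝ)) := by
    calc ∑ q ∈ S, ‖μ q * (calM1Factor c' χ q d l s / calM1Factor c' χ q 1 1 s) - 1‖
        ≤ ∑ q ∈ S, K * (D : ℝ) ^ (-(3 : ℝ)) := Finset.sum_le_sum hloc
      _ = S.card * (K * (D : ℝ) ^ (-(3 : ℝ))) := by rw [Finset.sum_const, nsmul_eq_mul]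
      _ ≤ ell D ^ 8 / 4 * (K * (D : ℝ) ^ (-(3 : ℝ))) := by gcongr
      _ ≤ 40320 * (D : ℝ) / 4 * (K * (D : ℝ) ^ (-(3 : ℝ))) := by
          gcongr; exact ell_pow_eight_le hD2
      _ = 10080 * K * ((D : ℝ) ^ (1 : ℝ) * (D : ℝ) ^ (-(3 : ℝ))) := by rw [Real.rpow_one]; ring
      _ = 10080 * K * (D : ℝ) ^ (-(2 : ℝ)) := by rw [← Real.rpow_add hD0]; norm_num
  have hsum1 : 10080 * K * (D : ℝ) ^ (-(2 : ℝ)) ≤ 1 := by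
    have h2 : (D : ℝ) ^ (-(2 : ℝ)) ≤ (D : ℝ) ^ (-(1 : ℝ)) :=
      Real.rpow_le_rpow_of_exponent_le hD1 (by norm_num)
    rw [Real.rpow_neg_one] at h2
    calc 10080 * K * (D : ℝ) ^ (-(2 : ℝ)) ≤ 10080 * K * (D : ℝ)⁻¹ := by gcongr
      _ = 10080 * K / D := by ring
      _ ≤ 1 := by rw [div_le_one hD0]; exact hDK
  -- conclude
  have hS0 : 0 ≤ ∑ q ∈ S, ‖μ q * (calM1Factor c' χ q d l s / calM1Factor c' χ q 1 1 s) - 1‖ :=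
    Finset.sum_nonneg fun q _ => norm_nonneg _
  refine (norm_prod_sub_one_le' S _).trans ?_
  have hexp := Real.abs_exp_sub_one_le (x := ∑ q ∈ S,
    ‖μ q * (calM1Factor c' χ q d l s / calM1Factor c' χ q 1 1 s) - 1‖)
    (by rw [abs_of_nonneg hS0]; exact hsum.trans hsum1)
  rw [abs_of_nonneg hS0] at hexp
  have := le_abs_self (Real.exp (∑ q ∈ S,
    ‖μ q * (calM1Factor c' χ q d l s / calM1Factor c' χ q 1 1 s) - 1‖) - 1)
  linarith


/-- **(15.21) on the whole support `n < P`**: for all large `D`, under (A), `1 ≤ j ≤ 3`, `1 ≤ n < P`,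
`(n,𝒬) = 1`: `‖ϖ₁ⱼ(n) − χ(n)ϱ*ⱼ(n)‖ ≤ C·τ₂(n)·D⁻²` — the hypothesis `h21` of the (15.22) edge
`Typed.Section15C.eq15_22_chi_of_parts`. (The argument of the tree edge `eq15_21_of_step15_u040`,
re-run on `step15_u040_wide`.) [cite: Zhang2022LandauSiegel, §15 (15.21) p.86] -/
theorem eq15_21_wide (c' : ℝ) :
    ∃ c : ℝ, 0 < c ∧ ∃ C : ℝ, Skeleton.ForAllLarge fun D _ χ => Skeleton.AssumptionA D χ →
      ∀ j ∈ ({1, 2, 3} : Finset ℕ), ∀ n : ℕ, 1 ≤ n → (n : ℝ) < Skeleton.bigP D →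
        Nat.Coprime n (Skeleton.frakq D) →
          ‖varpi1 c' χ j n - χ (n : ZMod D) * Skeleton.varrhoStar c' χ j n‖ ≤
            C * (n.divisors.card : ℝ) * (D : ℝ) ^ (-c) := by
  obtain ⟨c, hc, C, D₀, hS⟩ := step15_u040_wide c'
  refine ⟨c, hc, max C 0, max D₀ 2, fun D _ χ hD hq hp hA j hj n hn hnP hnq => ?_⟩
  have hD₀ : D₀ ≤ D := le_trans (le_max_left _ _) hD
  have hD2 : 2 ≤ D := le_trans (le_max_right _ _) hD
  have hnD : Nat.Coprime n D := coprime_of_coprime_frakq hD2 hnq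
  have h40' := hS D χ hD₀ hq hp hA j hj
  rw [chi_mul_varrhoStar_eq c' χ hq j hnD]
  unfold varpi1
  rw [← Finset.sum_sub_distrib]
  have hterm : ∀ x ∈ n.divisorsAntidiagonal,
      ‖lam1 c' χ x.1 1 * (x.1 : ℂ) ^ Skeleton.betaJ c' D j * χ (x.2 : ZMod D) *
            (calM1 c' χ x.1 x.2 (1 - Skeleton.betaJ c' D j) /
              calM1 c' χ 1 1 (1 - Skeleton.betaJ c' D j)) -
          (x.1 : ℂ) ^ Skeleton.betaJ c' D j * χ (x.2 : ZMod D)‖ ≤ max C 0 * (D : ℝ) ^ (-c) := by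
    intro x hx
    have hx' := Nat.mem_divisorsAntidiagonal.mp hx
    have hd1 : 1 ≤ x.1 := Nat.pos_of_ne_zero (fun h => by
      have := hx'.1; rw [h, zero_mul] at this; exact hx'.2 this.symm)
    have e : lam1 c' χ x.1 1 * (x.1 : ℂ) ^ Skeleton.betaJ c' D j * χ (x.2 : ZMod D) *
            (calM1 c' χ x.1 x.2 (1 - Skeleton.betaJ c' D j) /
              calM1 c' χ 1 1 (1 - Skeleton.betaJ c' D j)) -
          (x.1 : ℂ) ^ Skeleton.betaJ c' D j * χ (x.2 : ZMod D) =
        ((x.1 : ℂ) ^ Skeleton.betaJ c' D j * χ (x.2 : ZMod D)) *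
          (lam1 c' χ x.1 1 * calM1 c' χ x.1 x.2 (1 - Skeleton.betaJ c' D j) /
              calM1 c' χ 1 1 (1 - Skeleton.betaJ c' D j) - 1) := by ring
    rw [e, norm_mul, norm_mul, norm_natCast_cpow_betaJ c' D j hd1, one_mul]
    have hχ : ‖χ (x.2 : ZMod D)‖ ≤ 1 := DirichletCharacter.norm_le_one χ _
    have hu := h40' n x.1 x.2 hn hx'.1 hnP hnq
    have hC : C * (D : ℝ) ^ (-c) ≤ max C 0 * (D : ℝ) ^ (-c) :=
      mul_le_mul_of_nonneg_right (le_max_left _ _) (Real.rpow_nonneg (Nat.cast_nonneg _) _)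
    calc ‖χ (x.2 : ZMod D)‖ * ‖lam1 c' χ x.1 1 * calM1 c' χ x.1 x.2 (1 - Skeleton.betaJ c' D j) /
              calM1 c' χ 1 1 (1 - Skeleton.betaJ c' D j) - 1‖
        ≤ 1 * (max C 0 * (D : ℝ) ^ (-c)) :=
          mul_le_mul hχ (hu.trans hC) (norm_nonneg _) zero_le_one
      _ = max C 0 * (D : ℝ) ^ (-c) := one_mul _
  calc ‖∑ x ∈ n.divisorsAntidiagonal,
          (lam1 c' χ x.1 1 * (x.1 : ℂ) ^ Skeleton.betaJ c' D j * χ (x.2 : ZMod D) *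
              (calM1 c' χ x.1 x.2 (1 - Skeleton.betaJ c' D j) /
                calM1 c' χ 1 1 (1 - Skeleton.betaJ c' D j)) -
            (x.1 : ℂ) ^ Skeleton.betaJ c' D j * χ (x.2 : ZMod D))‖
      ≤ ∑ x ∈ n.divisorsAntidiagonal,
          ‖lam1 c' χ x.1 1 * (x.1 : ℂ) ^ Skeleton.betaJ c' D j * χ (x.2 : ZMod D) *
              (calM1 c' χ x.1 x.2 (1 - Skeleton.betaJ c' D j) /
                calM1 c' χ 1 1 (1 - Skeleton.betaJ c' D j)) -
            (x.1 : ℂ) ^ Skeleton.betaJ c' D j * χ (x.2 : ZMod D)‖ := norm_sum_le _ _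
    _ ≤ ∑ x ∈ n.divisorsAntidiagonal, max C 0 * (D : ℝ) ^ (-c) := Finset.sum_le_sum hterm
    _ = (n.divisorsAntidiagonal.card : ℝ) * (max C 0 * (D : ℝ) ^ (-c)) := by
          rw [Finset.sum_const, nsmul_eq_mul]
    _ = max C 0 * (n.divisors.card : ℝ) * (D : ℝ) ^ (-c) := by
          rw [← Nat.map_div_right_divisors, Finset.card_map]; ring

end Literature.NumberTheory.LFunctions.Zhang2022.Typed.Section15B
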